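import Summits.BirchSwinnertonDyer.BirchSwinnertonDyer.Theorems.ThetaPartnerAtTwoSignedControlAtTwoStubPlusHondaSystemTwo
import Summits.BirchSwinnertonDyer.BirchSwinnertonDyer.Theorems.ThetaPartnerAtTwoSignedControlAtTwoPlusTraceTwo
import Summits.BirchSwinnertonDyer.BirchSwinnertonDyer.Theorems.PrintX8VSInputHondaSystemSprungTowerRelations
import HarnessLib

/-!
# Sprung's Honda system AT `p = 2`, VI: SPRUNG PLUS POINTS on the `ℤ₂`-tower of `ℚ₂` for ANY even `a₂` — the `Δ`-traces
# `e_n = y_{n+2} + σ_{n+2}•y_{n+2}` of Sprung's tower points, their EXACT `K`-line trace relations, the logarithm of `e_n`, and the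
# non-divisibility of `y_1` (`Λ(y_1) = −2`)

Seat `bsd-2adic-tower-1` GEN 66, hand H2-C1 (pen GEN 40 SUMMON 20260831T155847Z): the `a₂ = ±2` rows of (C1)
`F1Sign2.HondaSystemAtTwoExists`. Sequel of IV (`…SprungIso`), V (`…SprungGenStep`). The a₂-generic twin of K3's
`SignedKatoOffTwo.LocalTwo` files 9–12 (`…LocalTwoRealTrace`, `…PlusPointsExact`, `…PlusPoints`), with the `K`-line relations obtained by
POINT ALGEBRA from the `Ω`-relation `SprungHonda.sum_act_sub_smul_add_eq_sum_act_one_sprung` (no logarithms of coset sums).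

SETTING (`Ω = ℚ̄₂`, `E = genFibΩ 2 M`, `e = toLoc hV : E(Ω) ≃ localPoints W ℚ_[2]`): `M/ℤ₂` with elliptic generic fibre and
`2 ∣ a₁` (`h₁`), `M ⊗ ℚ̄₂ = W ⊗ ℚ̄₂`; Sprung data `x 0 = 1`, `2x_1 = a`, `2x_{k+2} = a x_{k+1} − x_k` (`a : ℤ`); tower points
`c_m ∈ L(m) ∩ E₁` with `c_0 = O`, `Λ(c_m) = ∑_{k<m} x_k(ζ_{2^{m−k}} − 1)` (file `…SprungTowerPoints`); inverters `σ_m ζ_{2^m} = ζ_{2^m}⁻¹`.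
WHAT (THEOREMS ONLY; no definition, no named fact, no instance, no `sorry`; route-independent):
* §1 `sum_out_smul_eq_self_zero` (the one-element quotient `Stab ζ₁/Stab ζ₂` at `p = 2`), `smul_smul_comm_of_forall_mem_stab`,
  `sum_out_smul_smul_comm` (Galois elements commute on points fixed by a `Stab`);
* §2 `sprung_sum_smul_succ` — **`∑_{Stab ζ_{2^m}/Stab ζ_{2^{m+1}}} q̃•y_{m+1} = a•y_m − y_{m−1} + y_1`** (`m ≥ 1`; `y_m = e(c_m)`; at `p = 2`
  the right side of Sprung's relation, `∑_{Γ/Stab ζ₂} q̃•c_1`, is `c_1`);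
* §3 the plus points `e_n := y_{n+2} + σ_{n+2}•y_{n+2}`: `sprungPlus_zero` (`e_0 = (a+1)•y_1`), `sprungPlus_trace_one`
  (`∑_{Stab ζ₄/Stab ζ₈} q̃•e_1 = a•e_0`), `sprungPlus_trace_succ` (`∑_{Stab ζ_{2^{m+2}}/Stab ζ_{2^{m+3}}} q̃•e_{m+1} = a•e_m − e_{m−1} + 2•y_1`, `m ≥ 1`);
* §4 `sprungEll_add_smul_sub_v_mem_adjoin_v` (`ℓ_{m+3} + σ•ℓ_{m+3} − v_{m+3} ∈ ℚ₂(v_{m+2})`, the Sprung twin of K4's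
  `ell_add_smul_ell_sub_v_mem_adjoin_v`); §5 `sprung_one_ne_two_nsmul` (`−y_1 ∉ 2E(ℚ₂)` when `#Ẽ(𝔽₂)` is odd).
HONEST FRAMING: local theory at `2`; closes no item; BSD is not proved by any of this.

References: [Sprung2012] F. Sprung, J. Number Theory 132 (2012), Thm. 2.2 (1), (2′), Lemma 2.3; [Kobayashi2003] Lemma 8.9, Prop. 8.12;
[KuriharaOtsuki2006] §1.3, Prop. 1.4; [Washington1997] §13.1; cell memo MEMO-imc §10.90 / REF1 §139 R3.
-/

set_option autoImplicit false
-- the Theorems namespace of this sub repeats the summit name by design (D-0017 nested layout)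
set_option linter.dupNamespace false

noncomputable section

open scoped Classical Topology NNReal IntermediateField
open Filter PowerSeries Finset

namespace Summit.BirchSwinnertonDyer.BirchSwinnertonDyer.Theorems.SSHondaTwo

open Literature.RingTheory.FormalGroups WeierstrassCurve Field
open Summit.BirchSwinnertonDyer.Rank1Residual.Additive
open Summit.BirchSwinnertonDyer.Rank1Residual.Additive.PadicCyclotomicTower
open Summit.BirchSwinnertonDyer.Rank1Residual.Additive.BallEval
open Summit.BirchSwinnertonDyer.BirchSwinnertonDyer.Theorems.SignedKatoOffTwo.LocalAllPrimes
open Summit.BirchSwinnertonDyer.BirchSwinnertonDyer.Theorems.SignedKatoOffTwo.LocalTwo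
open Summit.BirchSwinnertonDyer.BirchSwinnertonDyer.Theorems.SignedEC.PlusLayer
open Summit.BirchSwinnertonDyer.BirchSwinnertonDyer.Theorems.SignedEC.PlusTower
open Literature.NumberTheory.EllipticCurves Literature.NumberTheory.EllipticCurves.FormalGroupChart
open Literature.NumberTheory.GaloisRepresentations
open Literature.NumberTheory.EllipticCurves.Rank1Residual

/-! ## §1 Small Galois bookkeeping at `p = 2` -/

section Galois

variable {K : Type} [Field K] [Algebra K ℚ_[2]] {W : WeierstrassCurve K}

/-- At `p = 2` the quotient `Stab ζ₁/Stab ζ₂ = Γ/Γ` has ONE element, so a coset sum of a `Γ`-fixed point is the point.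
[cite: SerreLocalFields1979, Ch. IV §4] -/
theorem sum_out_smul_eq_self_zero [Fintype (stab 2 0 ⧸ (stab 2 1).subgroupOf (stab 2 0))]
    {P : localPoints W ℚ_[2]} (hP : ∀ τ : Field.absoluteGaloisGroup ℚ_[2], τ • P = P) :
    ∑ q : stab 2 0 ⧸ (stab 2 1).subgroupOf (stab 2 0), ((q.out : stab 2 0) : Field.absoluteGaloisGroup ℚ_[2]) • P = P := by
  rw [Finset.sum_congr rfl fun q _ => hP _, Finset.sum_const, Finset.card_univ, ← Nat.card_eq_fintype_card,
    ← Subgroup.index, index_subgroupOf_stab_succ, if_pos rfl]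
  simp

/-- **Galois elements commute on a point fixed by `Stab ζ_{2^m}`** (they commute on `ζ_{2^m}`, so their commutator lies in
`Stab ζ_{2^m}`). [cite: Washington1997, §13.1] -/
theorem smul_smul_comm_of_forall_mem_stab {m : ℕ} (σ τ : Field.absoluteGaloisGroup ℚ_[2]) {P : localPoints W ℚ_[2]}
    (hP : ∀ ρ ∈ stab 2 m, ρ • P = P) : τ • σ • P = σ • τ • P := by
  have hc : (σ * τ)⁻¹ * (τ * σ) ∈ stab 2 m := by
    rw [mem_stab_iff, mul_smul, inv_smul_eq_iff, mul_smul, mul_smul, smul_zeta_comm]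
  calc τ • σ • P = (τ * σ) • P := (mul_smul τ σ P).symm
    _ = ((σ * τ) * ((σ * τ)⁻¹ * (τ * σ))) • P := by rw [mul_inv_cancel_left]
    _ = (σ * τ) • (((σ * τ)⁻¹ * (τ * σ)) • P) := mul_smul _ _ P
    _ = σ • τ • P := by rw [hP _ hc, mul_smul]

/-- A coset sum over `Stab ζ_{2^m}/Stab ζ_{2^{m+1}}` commutes with any `σ` on a point fixed by `Stab ζ_{2^{m+1}}`. [folklore] -/
theorem sum_out_smul_smul_comm {m : ℕ} [Fintype (stab 2 m ⧸ (stab 2 (m + 1)).subgroupOf (stab 2 m))]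
    (σ : Field.absoluteGaloisGroup ℚ_[2]) {P : localPoints W ℚ_[2]} (hP : ∀ ρ ∈ stab 2 (m + 1), ρ • P = P) :
    ∑ q : stab 2 m ⧸ (stab 2 (m + 1)).subgroupOf (stab 2 m), ((q.out : stab 2 m) : Field.absoluteGaloisGroup ℚ_[2]) • σ • P =
      σ • ∑ q : stab 2 m ⧸ (stab 2 (m + 1)).subgroupOf (stab 2 m), ((q.out : stab 2 m) : Field.absoluteGaloisGroup ℚ_[2]) • P := by
  rw [Finset.smul_sum]
  exact Finset.sum_congr rfl fun q _ => smul_smul_comm_of_forall_mem_stab σ _ hP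

end Galois

/-! ## §2 Sprung's relation on the `ℤ₂`-tower points, in `localPoints W ℚ_[2]` -/

section Loc

variable {K : Type} [Field K] [Algebra K ℚ_[2]] {W : WeierstrassCurve K} {M : WeierstrassCurve ℤ_[2]}
  [hE : (M.map PadicInt.Coe.ringHom).IsElliptic] [hEt : (M.map PadicInt.toZMod).IsElliptic]
  [hintΩ : (genFibΩ 2 M).IsIntegral (Valued.v (R := PadicAlgCl 2)).integer]
  (hV : genFibΩ 2 M = W.baseChange (AlgebraicClosure ℚ_[2]))
  {a : ℤ} {x : ℕ → ℚ_[2]} {c : ℕ → (genFibΩ 2 M).toAffine.Point}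

omit hE hEt hintΩ in
/-- A tower point `c_m ∈ L(m)` is fixed by `Stab ζ_{2^m}`. [folklore] -/
theorem smul_toLoc_eq_of_mem_layer
    (hcL : ∀ n, c n ∈ subfieldPoints (genFibΩ 2 M) (layer 2 n).toSubfield coeffs_mem_layer)
    (m : ℕ) {τ : Field.absoluteGaloisGroup ℚ_[2]} (hτ : τ ∈ stab 2 m) : τ • toLoc hV (c m) = toLoc hV (c m) := by
  refine (forall_smul_eq_iff_mem_subfieldPoints hV m _).mpr ?_ τ hτ
  rw [AddEquiv.symm_apply_apply]; exact hcL m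

omit hE hEt hintΩ in
/-- The bottom tower point `c_1 ∈ E(ℚ₂)` is fixed by all of `Γ` (`Stab ζ₂ = Γ`). [folklore] -/
theorem smul_toLoc_one_eq_of_mem_layer
    (hcL : ∀ n, c n ∈ subfieldPoints (genFibΩ 2 M) (layer 2 n).toSubfield coeffs_mem_layer)
    (τ : Field.absoluteGaloisGroup ℚ_[2]) : τ • toLoc hV (c 1) = toLoc hV (c 1) :=
  smul_toLoc_eq_of_mem_layer hV hcL 1 (by rw [stab_two_one]; exact Subgroup.mem_top τ)

/-- **Sprung's relation (1) at `p = 2` in `localPoints`**: for `m ≥ 1`,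
`∑_{Stab ζ_{2^m}/Stab ζ_{2^{m+1}}} q̃ • y_{m+1} = a • y_m − y_{m−1} + y_1` (`y_m = toLoc (c_m)`), from
`SprungHonda.sum_act_sub_smul_add_eq_sum_act_one_sprung` (whose right side `∑_{Γ/Stab ζ₂} q̃ ⋆ c_1` is `c_1` at `p = 2`) and the
torsion-freeness of the layers at a good supersingular `2` (`2 ∣ a₁`). [cite: Sprung2012, Thm. 2.2 (1), (2′)] [cite: Kobayashi2003, Lemma 8.9] -/
theorem sprung_sum_smul_succ (h₁ : M.a₁ ∈ IsLocalRing.maximalIdeal ℤ_[2])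
    (hx0 : x 0 = 1) (hx1 : ((2 : ℕ) : ℚ_[2]) * x 1 = a) (hrec : ∀ k, ((2 : ℕ) : ℚ_[2]) * x (k + 2) = a * x (k + 1) - x k)
    (hcL : ∀ n, c n ∈ subfieldPoints (genFibΩ 2 M) (layer 2 n).toSubfield coeffs_mem_layer)
    (hck : ∀ n, c n ∈ kernel (Valued.v (R := PadicAlgCl 2)) (genFibΩ 2 M))
    (hcΛ : ∀ n, ptLogΩ 2 M (c n) = ∑ k ∈ range n, algebraMap ℚ_[2] (PadicAlgCl 2) (x k) * (zeta 2 (n - k) - 1))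
    {m : ℕ} (hm : 1 ≤ m) [Fintype (stab 2 m ⧸ (stab 2 (m + 1)).subgroupOf (stab 2 m))] :
    ∑ q : stab 2 m ⧸ (stab 2 (m + 1)).subgroupOf (stab 2 m),
        ((q.out : stab 2 m) : Field.absoluteGaloisGroup ℚ_[2]) • toLoc hV (c (m + 1)) =
      a • toLoc hV (c m) - toLoc hV (c (m - 1)) + toLoc hV (c 1) := by
  haveI : Fintype (stab 2 0 ⧸ (stab 2 1).subgroupOf (stab 2 0)) := by
    haveI := finite_stab_quot 0; exact Fintype.ofFinite _
  set e := toLoc hV with he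
  set act : Field.absoluteGaloisGroup ℚ_[2] → (genFibΩ 2 M).toAffine.Point → (genFibΩ 2 M).toAffine.Point :=
    fun τ Q => e.symm (τ • e Q) with hact_def
  have hact0 : ∀ τ, act τ 0 = 0 := fun τ => act_zero hV τ
  have hact : ∀ τ (x y : PadicAlgCl 2) (h : (genFibΩ 2 M).toAffine.Nonsingular x y),
      ∃ h', act τ (Affine.Point.some x y h) = Affine.Point.some (τ • x) (τ • y) h' := fun τ x y h => act_some hV τ x y h
  have he_act : ∀ τ Q, e (act τ Q) = τ • e Q := fun τ Q => by simp only [hact_def, AddEquiv.apply_symm_apply]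
  have htors : ∀ n, 1 ≤ n → ∀ Q ∈ subfieldPoints (genFibΩ 2 M) (layer 2 n).toSubfield coeffs_mem_layer,
      ∀ k : ℕ, 2 ^ k • Q = 0 → Q = 0 :=
    fun n _ Q hQ k hk ↦ eq_zero_of_two_pow_smul_eq_zero_of_mem_subfieldPoints_layer M h₁ n hQ hk
  have hrel := SprungHonda.sum_act_sub_smul_add_eq_sum_act_one_sprung act hx0 hx1 hrec hact0 hact hcL hck hcΛ htors hm
  have hrel' := congrArg e hrel
  simp only [map_add, map_sub, map_sum, map_zsmul, he_act] at hrel'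
  rw [sum_out_smul_eq_self_zero (smul_toLoc_one_eq_of_mem_layer hV hcL)] at hrel'
  rw [← hrel']
  abel

/-! ## §3 The Sprung plus points `e_n = y_{n+2} + σ_{n+2}•y_{n+2}` and their `K`-line traces -/

/-- **`e_0 = (a + 1) • y_1`**: `y_2 + σ_2•y_2 = ∑_{Γ/Stab ζ₄} q̃•y_2 = a•y_1 − y_0 + y_1` with `y_0 = O`.
[cite: Sprung2012, Thm. 2.2 (2′)] [cite: KuriharaOtsuki2006, §1.3] -/
theorem sprungPlus_zero (h₁ : M.a₁ ∈ IsLocalRing.maximalIdeal ℤ_[2])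
    (hx0 : x 0 = 1) (hx1 : ((2 : ℕ) : ℚ_[2]) * x 1 = a) (hrec : ∀ k, ((2 : ℕ) : ℚ_[2]) * x (k + 2) = a * x (k + 1) - x k)
    (hc0 : c 0 = 0)
    (hcL : ∀ n, c n ∈ subfieldPoints (genFibΩ 2 M) (layer 2 n).toSubfield coeffs_mem_layer)
    (hck : ∀ n, c n ∈ kernel (Valued.v (R := PadicAlgCl 2)) (genFibΩ 2 M))
    (hcΛ : ∀ n, ptLogΩ 2 M (c n) = ∑ k ∈ range n, algebraMap ℚ_[2] (PadicAlgCl 2) (x k) * (zeta 2 (n - k) - 1))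
    {σ₂ : Field.absoluteGaloisGroup ℚ_[2]} (hσ₂ : σ₂ • zeta 2 2 = (zeta 2 2)⁻¹) :
    toLoc hV (c 2) + σ₂ • toLoc hV (c 2) = (a + 1) • toLoc hV (c 1) := by
  haveI : Fintype (stab 2 1 ⧸ (stab 2 (1 + 1)).subgroupOf (stab 2 1)) := by
    haveI := finite_stab_quot 1; exact Fintype.ofFinite _
  have hσ₂' : σ₂ ∉ stab 2 2 := by
    intro h
    rw [mem_stab_iff] at h
    rw [h] at hσ₂
    have hζ4 : IsPrimitiveRoot (zeta 2 2) (2 * 2) := by simpa using isPrimitiveRoot_zeta 2 2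
    have hsq : zeta 2 2 ^ 2 = -1 := (hζ4.pow (by norm_num) rfl).eq_neg_one_of_two_right
    have hne : zeta 2 2 ≠ 0 := hζ4.ne_zero (by norm_num)
    have : zeta 2 2 ^ 2 = 1 := by rw [sq, ← mul_inv_cancel₀ hne, ← hσ₂]
    rw [hsq] at this
    norm_num at this
  have hsum := sum_out_eq_add (m := 1) le_rfl (fun τ ↦ τ • toLoc hV (c 2))
    (fun σ τ hτ ↦ by rw [mul_smul, smul_toLoc_eq_of_mem_layer hV hcL 2 hτ])
    (by rw [stab_two_one]; exact Subgroup.mem_top σ₂) hσ₂'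
  have hrel : ∑ q : stab 2 1 ⧸ (stab 2 (1 + 1)).subgroupOf (stab 2 1),
      ((q.out : stab 2 1) : Field.absoluteGaloisGroup ℚ_[2]) • toLoc hV (c 2) =
      a • toLoc hV (c 1) - toLoc hV (c 0) + toLoc hV (c 1) :=
    sprung_sum_smul_succ hV h₁ hx0 hx1 hrec hcL hck hcΛ (m := 1) le_rfl
  rw [hsum, one_smul] at hrel
  rw [hrel, hc0, map_zero, sub_zero, add_smul, one_smul]

/-- **The `K`-line trace of `e_{m+1}` for `m ≥ 1`**: `∑_{Stab ζ_{2^{m+2}}/Stab ζ_{2^{m+3}}} q̃•(y_{m+3} + σ_{m+3}•y_{m+3})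
= a•(y_{m+2} + σ_{m+2}•y_{m+2}) − (y_{m+1} + σ_{m+1}•y_{m+1}) + 2•y_1` — Sprung's relation (1) plus its `σ`-conjugate (the coset sum
commutes with `σ`; all inverters agree on each `y_k`; `σ•y_1 = y_1`). [cite: Sprung2012, Thm. 2.2 (1)] [cite: KuriharaOtsuki2006, Prop. 1.4] -/
theorem sprungPlus_trace_succ (h₁ : M.a₁ ∈ IsLocalRing.maximalIdeal ℤ_[2])
    (hx0 : x 0 = 1) (hx1 : ((2 : ℕ) : ℚ_[2]) * x 1 = a) (hrec : ∀ k, ((2 : ℕ) : ℚ_[2]) * x (k + 2) = a * x (k + 1) - x k)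
    (hcL : ∀ n, c n ∈ subfieldPoints (genFibΩ 2 M) (layer 2 n).toSubfield coeffs_mem_layer)
    (hck : ∀ n, c n ∈ kernel (Valued.v (R := PadicAlgCl 2)) (genFibΩ 2 M))
    (hcΛ : ∀ n, ptLogΩ 2 M (c n) = ∑ k ∈ range n, algebraMap ℚ_[2] (PadicAlgCl 2) (x k) * (zeta 2 (n - k) - 1))
    {σ : ℕ → Field.absoluteGaloisGroup ℚ_[2]} (hσ : ∀ m, 1 ≤ m → σ m • zeta 2 m = (zeta 2 m)⁻¹)
    {m : ℕ} (hm : 1 ≤ m) [Fintype (stab 2 (m + 2) ⧸ (stab 2 (m + 2 + 1)).subgroupOf (stab 2 (m + 2)))] :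
    ∑ q : stab 2 (m + 2) ⧸ (stab 2 (m + 2 + 1)).subgroupOf (stab 2 (m + 2)),
        ((q.out : stab 2 (m + 2)) : Field.absoluteGaloisGroup ℚ_[2]) •
          (toLoc hV (c (m + 3)) + σ (m + 3) • toLoc hV (c (m + 3))) =
      a • (toLoc hV (c (m + 2)) + σ (m + 2) • toLoc hV (c (m + 2))) -
        (toLoc hV (c (m + 1)) + σ (m + 1) • toLoc hV (c (m + 1))) + 2 • toLoc hV (c 1) := by
  have hrel : ∑ q : stab 2 (m + 2) ⧸ (stab 2 (m + 2 + 1)).subgroupOf (stab 2 (m + 2)),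
      ((q.out : stab 2 (m + 2)) : Field.absoluteGaloisGroup ℚ_[2]) • toLoc hV (c (m + 3)) =
      a • toLoc hV (c (m + 2)) - toLoc hV (c (m + 1)) + toLoc hV (c 1) :=
    sprung_sum_smul_succ hV h₁ hx0 hx1 hrec hcL hck hcΛ (m := m + 2) (by omega)
  have hfix3 : ∀ ρ ∈ stab 2 (m + 2 + 1), ρ • toLoc hV (c (m + 3)) = toLoc hV (c (m + 3)) := fun ρ hρ ↦
    smul_toLoc_eq_of_mem_layer hV hcL (m + 3) hρ
  simp_rw [smul_add]
  rw [Finset.sum_add_distrib, sum_out_smul_smul_comm (σ (m + 3)) hfix3, hrel, smul_add, smul_sub,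
    smul_toLoc_one_eq_of_mem_layer hV hcL (σ (m + 3)), smul_comm (σ (m + 3)) a,
    smul_eq_smul_of_smul_zeta_eq_inv (hσ (m + 2) (by omega))
      (smul_zeta_eq_inv_of_le (by omega : m + 2 ≤ m + 3) (hσ (m + 3) (by omega)))
      (fun τ hτ => smul_toLoc_eq_of_mem_layer hV hcL (m + 2) hτ),
    smul_eq_smul_of_smul_zeta_eq_inv (hσ (m + 1) (by omega))
      (smul_zeta_eq_inv_of_le (by omega : m + 1 ≤ m + 3) (hσ (m + 3) (by omega)))
      (fun τ hτ => smul_toLoc_eq_of_mem_layer hV hcL (m + 1) hτ), two_nsmul]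
  abel

/-- **The `K`-line trace of `e_1`**: `∑_{Stab ζ₄/Stab ζ₈} q̃•(y_3 + σ_3•y_3) = a•(y_2 + σ_2•y_2)` (the term `−(y_1 + σ_3•y_1) + 2•y_1`
vanishes since `σ_3•y_1 = y_1`). [cite: Sprung2012, Thm. 2.2 (1), (2′)] [cite: KuriharaOtsuki2006, Prop. 1.4] -/
theorem sprungPlus_trace_one (h₁ : M.a₁ ∈ IsLocalRing.maximalIdeal ℤ_[2])
    (hx0 : x 0 = 1) (hx1 : ((2 : ℕ) : ℚ_[2]) * x 1 = a) (hrec : ∀ k, ((2 : ℕ) : ℚ_[2]) * x (k + 2) = a * x (k + 1) - x k)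
    (hcL : ∀ n, c n ∈ subfieldPoints (genFibΩ 2 M) (layer 2 n).toSubfield coeffs_mem_layer)
    (hck : ∀ n, c n ∈ kernel (Valued.v (R := PadicAlgCl 2)) (genFibΩ 2 M))
    (hcΛ : ∀ n, ptLogΩ 2 M (c n) = ∑ k ∈ range n, algebraMap ℚ_[2] (PadicAlgCl 2) (x k) * (zeta 2 (n - k) - 1))
    {σ : ℕ → Field.absoluteGaloisGroup ℚ_[2]} (hσ : ∀ m, 1 ≤ m → σ m • zeta 2 m = (zeta 2 m)⁻¹)
    [Fintype (stab 2 2 ⧸ (stab 2 (2 + 1)).subgroupOf (stab 2 2))] :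
    ∑ q : stab 2 2 ⧸ (stab 2 (2 + 1)).subgroupOf (stab 2 2),
        ((q.out : stab 2 2) : Field.absoluteGaloisGroup ℚ_[2]) • (toLoc hV (c 3) + σ 3 • toLoc hV (c 3)) =
      a • (toLoc hV (c 2) + σ 2 • toLoc hV (c 2)) := by
  have hrel : ∑ q : stab 2 2 ⧸ (stab 2 (2 + 1)).subgroupOf (stab 2 2),
      ((q.out : stab 2 2) : Field.absoluteGaloisGroup ℚ_[2]) • toLoc hV (c 3) =
      a • toLoc hV (c 2) - toLoc hV (c 1) + toLoc hV (c 1) :=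
    sprung_sum_smul_succ hV h₁ hx0 hx1 hrec hcL hck hcΛ (m := 2) (by omega)
  have hfix3 : ∀ ρ ∈ stab 2 (2 + 1), ρ • toLoc hV (c 3) = toLoc hV (c 3) := fun ρ hρ ↦
    smul_toLoc_eq_of_mem_layer hV hcL 3 hρ
  simp_rw [smul_add]
  rw [Finset.sum_add_distrib, sum_out_smul_smul_comm (σ 3) hfix3, hrel, sub_add_cancel, smul_comm (σ 3) a,
    smul_eq_smul_of_smul_zeta_eq_inv (hσ 2 (by omega))
      (smul_zeta_eq_inv_of_le (by omega : 2 ≤ 3) (hσ 3 (by omega)))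
      (fun τ hτ => smul_toLoc_eq_of_mem_layer hV hcL 2 hτ)]

end Loc

/-! ## §4 The logarithm of the Sprung plus point: `ℓ_{m+3} + σ•ℓ_{m+3} ≡ v_{m+3} (mod ℚ₂(v_{m+2}))` -/

/-- **The logarithm of the Sprung plus point lies in `v_{m+3} + ℚ₂(v_{m+2})`** (`x_0 = 1`; every inverter `σ` of `ζ_{2^{m+3}}`):
`ℓ_{m+3} + σ•ℓ_{m+3} − (ζ_{2^{m+3}} + ζ_{2^{m+3}}⁻¹ − 2) ∈ ℚ_[2]⟮ζ_{2^{m+2}} + ζ_{2^{m+2}}⁻¹ − 2⟯` where `ℓ_n = ∑_{k<n} x_k(ζ_{2^{n−k}} − 1)`.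
With `t := ℓ_{m+3} − (ζ − 1) ∈ ℚ₂(ζ_{2^{m+2}})` (`SprungHonda.sprungEll_sub_mem_layer_pred`) the left side is `t + σ•t`, fixed by `σ`
(`σ² ∈ Stab`), hence in the plus field. The Sprung twin of `SignedEC.PlusLayer.ell_add_smul_ell_sub_v_mem_adjoin_v`.
[cite: Kobayashi2003, Lemma 8.9, Prop. 8.11] [cite: Washington1997, §13.1] -/
theorem sprungEll_add_smul_sub_v_mem_adjoin_v {x : ℕ → ℚ_[2]} (hx0 : x 0 = 1) (m : ℕ) {σ : absoluteGaloisGroup ℚ_[2]}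
    (hσ : σ • zeta 2 (m + 3) = (zeta 2 (m + 3))⁻¹) :
    (∑ k ∈ range (m + 3), algebraMap ℚ_[2] (PadicAlgCl 2) (x k) * (zeta 2 (m + 3 - k) - 1)) +
        σ • (∑ k ∈ range (m + 3), algebraMap ℚ_[2] (PadicAlgCl 2) (x k) * (zeta 2 (m + 3 - k) - 1)) -
        (zeta 2 (m + 3) + (zeta 2 (m + 3))⁻¹ - 2) ∈
      ℚ_[2]⟮zeta 2 (m + 2) + (zeta 2 (m + 2))⁻¹ - 2⟯ := by
  set ζ := zeta 2 (m + 3) with hζ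
  set ℓ := ∑ k ∈ range (m + 3), algebraMap ℚ_[2] (PadicAlgCl 2) (x k) * (zeta 2 (m + 3 - k) - 1) with hℓ
  set t := ℓ - (ζ - 1) with ht
  have htL : t ∈ layer 2 (m + 2) := by
    have h := SprungHonda.sprungEll_sub_mem_layer_pred (p := 2) hx0 (m := m + 3) (by omega)
    rwa [show m + 3 - 1 = m + 2 by omega] at h
  have htL' : t ∈ layer 2 (m + 3) := layer_mono 2 (by omega) htL
  have hσ1 : σ • (ζ - 1) = ζ⁻¹ - 1 := by rw [smul_sub, hσ, smul_one]
  have e : ℓ + σ • ℓ - (ζ + ζ⁻¹ - 2) = t + σ • t := by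
    rw [ht, smul_sub, hσ1]; ring
  rw [e, ← adjoin_u_eq_adjoin_v]
  have hσ2 : σ • zeta 2 (m + 2) = (zeta 2 (m + 2))⁻¹ := by
    rw [← zeta_succ_pow 2 (m + 2), smul_pow', ← hζ, hσ, inv_pow]
  refine (mem_adjoin_u_iff_mem_layer_and_smul_eq hσ2 _).mpr ⟨add_mem htL (smul_mem_layer σ htL), ?_⟩
  have hσσ : σ * σ ∈ stab 2 (m + 3) := by
    rw [mem_stab_iff, mul_smul, ← hζ, hσ, smul_inv'', hσ, inv_inv]
  rw [smul_add, ← mul_smul, smul_eq_self_of_mem_stab hσσ htL', add_comm]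

/-! ## §5 Non-divisibility of `y_1`: `Λ(y_1) = −2` -/

section NonDiv

variable {K : Type} [Field K] [Algebra K ℚ_[2]] {W : WeierstrassCurve K} {M : WeierstrassCurve ℤ_[2]}
  [hE : (M.map PadicInt.Coe.ringHom).IsElliptic] [hEt : (M.map PadicInt.toZMod).IsElliptic]
  [hintΩ : (genFibΩ 2 M).IsIntegral (Valued.v (R := PadicAlgCl 2)).integer]
  (hV : genFibΩ 2 M = W.baseChange (AlgebraicClosure ℚ_[2]))
  {x : ℕ → ℚ_[2]} {c : ℕ → (genFibΩ 2 M).toAffine.Point}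

/-- **`−y_1 ∉ 2·E(ℚ₂)`** when `#Ẽ(𝔽₂)` is odd (good supersingular `2`): `Λ(c_1) = x_0(ζ_2 − 1) = −2` has `‖·‖ = ‖2‖`, whereas for
a `Γ`-fixed `b`, `#Ẽ • b ∈ Ê(2ℤ₂)` and `Λ(2 • #Ẽ • b) = 2Λ(#Ẽ • b)` has `‖·‖ ≤ ‖4‖`. [cite: KuriharaOtsuki2006, §1.3]
[cite: SilvermanAEC2009, VII.2 Prop. 2.1, IV.6.4] -/
theorem sprung_one_ne_two_nsmul (hx0 : x 0 = 1)
    (hodd : Odd (Nat.card (M.map PadicInt.toZMod).toAffine.Point))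
    (hcL : ∀ n, c n ∈ subfieldPoints (genFibΩ 2 M) (layer 2 n).toSubfield coeffs_mem_layer)
    (hck : ∀ n, c n ∈ kernel (Valued.v (R := PadicAlgCl 2)) (genFibΩ 2 M))
    (hcΛ : ∀ n, ptLogΩ 2 M (c n) = ∑ k ∈ range n, algebraMap ℚ_[2] (PadicAlgCl 2) (x k) * (zeta 2 (n - k) - 1))
    {b : localPoints W ℚ_[2]} (hb : ∀ τ : Field.absoluteGaloisGroup ℚ_[2], τ • b = b) :
    -toLoc hV (c 1) ≠ 2 • b := by
  intro heq
  set N := Nat.card (M.map PadicInt.toZMod).toAffine.Point with hN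
  have hΛ1 : ptLogΩ 2 M (c 1) = -2 := by
    rw [hcΛ 1, sum_range_one, hx0, map_one, one_mul, Nat.sub_zero]
    have hz : zeta 2 1 = -1 := by
      have h := isPrimitiveRoot_zeta 2 1
      rw [pow_one] at h
      exact h.eq_neg_one_of_two_right
    rw [hz]; norm_num
  -- `b` and `N • b` as `Ω`-points with coordinates in `ℚ₂`; `N • b ∈ E₁`
  have hB : (toLoc hV).symm b ∈ subfieldPoints (genFibΩ 2 M) (layer 2 0).toSubfield coeffs_mem_layer :=
    (forall_smul_eq_iff_mem_subfieldPoints hV 0 b).mp fun τ _ => hb τ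
  have hNBk : N • (toLoc hV).symm b ∈ kernel (Valued.v (R := PadicAlgCl 2)) (genFibΩ 2 M) :=
    card_smul_mem_kernel_of_mem_subfieldPoints M hB
  have hNBL : N • (toLoc hV).symm b ∈ subfieldPoints (genFibΩ 2 M) (layer 2 0).toSubfield coeffs_mem_layer :=
    (subfieldPoints _ _ _).nsmul_mem hB N
  -- `N • (−c_1) = 2 • (N • b)`
  have heq' : (-1 : ℤ) • c 1 = 2 • (toLoc hV).symm b := by
    have h := congrArg (toLoc hV).symm heq
    rwa [map_neg, AddEquiv.symm_apply_apply, map_nsmul, ← neg_one_zsmul] at h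
  have hrel : N • ((-1 : ℤ) • c 1) = 2 • (N • (toLoc hV).symm b) := by rw [heq', smul_comm]
  have hlog := congrArg (ptLogΩ 2 M) hrel
  rw [ptLogΩ_nsmul (m := 1) ((subfieldPoints _ _ _).zsmul_mem (hcL 1) _)
      ((kernel (Valued.v (R := PadicAlgCl 2)) (genFibΩ 2 M)).zsmul_mem (hck 1) _) N,
    ptLogΩ_zsmul (m := 1) (hcL 1) (hck 1) (-1), hΛ1, ptLogΩ_nsmul (m := 0) hNBL hNBk 2] at hlog
  -- `Λ(N • b) = N`, of norm `1` since `N` is odd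
  have hΛ : ptLogΩ 2 M (N • (toLoc hV).symm b) = N := by
    have h2 : (2 : PadicAlgCl 2) ≠ 0 := two_ne_zero
    apply mul_left_cancel₀ h2
    push_cast at hlog
    linear_combination -hlog
  have hnorm : ‖ptLogΩ 2 M (N • (toLoc hV).symm b)‖ = 1 := by
    rw [hΛ, show (N : PadicAlgCl 2) = algebraMap ℚ_[2] (PadicAlgCl 2) ((N : ℤ) : ℚ_[2]) by push_cast; rfl,
      norm_algebraMap']
    refine le_antisymm (Padic.norm_int_le_one _) (not_lt.mp fun h => ?_)
    rw [Padic.norm_intCast_lt_one_iff] at h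
    obtain ⟨j, hj⟩ := hodd
    omega
  have hle := norm_ptLogΩ_le_half_of_mem_layer_zero (M := M) hNBL hNBk
  linarith

end NonDiv

end Summit.BirchSwinnertonDyer.BirchSwinnertonDyer.Theorems.SSHondaTwo

end
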